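import Literature.Barriers.NavierStokesRegularity.ComplexNavierStokesBlowupSeriesSingularTime
import Mathlib.Analysis.SpecialFunctions.Integrals.Basic
import HarnessLib

/-!
# Li–Sinai complex Navier–Stokes blow-up: bounds uniform in time, finite energy for large times

Seventh file of the barrier entry `ComplexNavierStokesBlowup` (D-0021), companion of
`ComplexNavierStokesBlowupSeries.lean` (the power series (3) of D. Li, Ya. G. Sinai, *Blow ups of
complex solutions of the 3D Navier–Stokes system and renormalization group method*, J. Eur. Math.
Soc. 10 (2008) 267–313, §2, PROVED there to solve the integral equation (1) at all times),
`ComplexNavierStokesBlowupSeriesEnergy.lean` (finite energy for SMALL times, `t < t₀`, for every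
amplitude; the named fact `LiSinaiSeriesEnergyInfinite`) and
`ComplexNavierStokesBlowupSeriesSingularTime.lean` (first singular time; geometric decay of the
modes at a time gives finite energy at that time). Everything in this file is PROVED; no new
fact is stated. (Fourier space is `EuclideanSpace ℝ (Fin 3)`; `k 2` is the third coordinate
`k₃`; `mode v₀ p t` is the `p`-th term of the series (3)/(46) at time `t`, amplitude absorbed
into the datum.)

## What is here (ours; elementary)

The bounds of the Energy file lose the heat factor `e^{-(t-s)|k|²} ≤ 1` and therefore grow like
`t^q`; they say nothing for large times. Keeping the heat factor gives bounds UNIFORM in time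
with Gaussian decay:

* `LiSinai.enorm_mode_le_gauss_maj`: for a datum vanishing off `{a ≤ k₃, |k| ≤ R}` with `a > 0`,
  `‖mode v₀ q (t, k)‖ ≤ e^{-t|k|²/q} h_q(k)` for ALL `t ≥ 0`, where the time-free majorants
  `h_q = LiSinai.maj v₀ a q` are `h₁ = |v₀|`, `h_q = (4/(q a)) Σ_{p₁+p₂=q} h_{p₁} ∗ h_{p₂}`.
  Ingredients: the Gaussian weights are sub-multiplicative under convolution,
  `e^{-s|x|²/p₁} e^{-s|y|²/p₂} ≤ e^{-s|x+y|²/(p₁+p₂)}` (`|x+y|²/(p₁+p₂) ≤ |x|²/p₁ + |y|²/p₂`,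
  `LiSinai.norm_add_sq_div_le`), and the damped Duhamel kernel integrates to
  `∫₀ᵗ e^{-(t-s)|k|²} e^{-s|k|²/q} ds ≤ 2 e^{-t|k|²/q}/|k|²` (`q ≥ 2`), whose `1/|k|²` beats the
  symbol `|k|` on the support `{k₃ ≥ q a}` of the `q`-th mode: `4|k|/|k|² ≤ 4/(q a)`.
* `LiSinai.maj_norm_bounds`: `‖h_q‖₁ ≤ ν K^{q-1}` and `‖h_q‖_∞ ≤ M₀ K^{q-1}` with
  `ν = M₀ vol B(0,R)` and `K = 4ν/a` — the factor `1/q` absorbs the `q - 1` terms of the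
  quadratic recursion, so a purely geometric ansatz closes (no Catalan numbers).
* `LiSinai.enorm_mode_le_geometric_exp`: hence `‖mode v₀ q (t, k)‖ ≤ M₀ K^{q-1} e^{-t q a²}` for
  all `t ≥ 0` (`|k|² ≥ (q a)²` on the support).
* `LiSinai.seriesSolution_energy_lt_top_of_exp_lt` (**the energy returns**): the series solution
  has finite energy at every time `t ≥ 0` with `K e^{-t a²} < 1`, in particular at all
  `t ≥ (K + 1)/a²` (`LiSinai.seriesSolution_energy_lt_top_of_le`, `LiSinai.lt_of_energy_eq_top`);
  so the set of infinite-energy times of any admissible datum is bounded (and is contained in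
  `[t₀, (K+1)/a²)` by the Energy file).
* `LiSinai.seriesSolution_energy_lt_top_of_small` (**small one-sided data never blow up**): if
  `4 M₀ vol B(0,R) < a` then the energy is finite at ALL times `t ≥ 0`. Consequently every
  witness of `LiSinaiSeriesEnergyInfinite` / `LiSinaiSeriesEnergyBlowup` (hence the critical
  datum `A_cr v(k,0)` of §10) has `a ≤ 4 M₀ vol B(0,R)` (`LiSinai.le_of_energy_eq_top`,
  `LiSinaiSeriesEnergyInfinite.exists_large_witness`): blow-up of the complex one-sided
  solutions is a LARGE-data phenomenon, quantitatively.

Nothing here gives a lower bound on the modes (Theorem 1 of the source, p. 311, the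
renormalisation-group part with computer-numerical steps §7 p. 302); the target facts are not
discharged.

## References

* D. Li, Ya. G. Sinai, J. Eur. Math. Soc. 10 (2008) 267–313: §2 p. 269–270 (eqs. (3)–(6),
  `supp g_p`, "the series (3) converges for sufficiently small `s`"), Thm. 1 p. 311, §10 p. 312.
  [`LiSinai2008`]
-/

noncomputable section

open MeasureTheory Set Filter Topology Finset
open scoped ENNReal InnerProductSpace RealInnerProductSpace BigOperators

namespace Literature.Barriers.NavierStokesRegularity

/-- Local notation for Fourier space `ℝ³ = EuclideanSpace ℝ (Fin 3)`; `k 2` is the third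
coordinate `k₃`. -/
local notation "ℝ³" => EuclideanSpace ℝ (Fin 3)

namespace LiSinai

/-! ### Gaussian weights are sub-multiplicative under convolution -/

/-- `|x + y|²/(p + q) ≤ |x|²/p + |y|²/q` for `p, q > 0` (equivalently `0 ≤ |q x - p y|²`).
[folklore] -/
theorem norm_add_sq_div_le (x y : ℝ³) {p q : ℝ} (hp : 0 < p) (hq : 0 < q) :
    ‖x + y‖ ^ 2 / (p + q) ≤ ‖x‖ ^ 2 / p + ‖y‖ ^ 2 / q := by
  have h1 : ‖x + y‖ ^ 2 = ‖x‖ ^ 2 + 2 * ⟪x, y⟫ + ‖y‖ ^ 2 := norm_add_sq_real x y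
  have h2 : ‖q • x - p • y‖ ^ 2 = ‖q • x‖ ^ 2 - 2 * ⟪q • x, p • y⟫ + ‖p • y‖ ^ 2 :=
    norm_sub_sq_real _ _
  have h3 : ⟪q • x, p • y⟫ = q * p * ⟪x, y⟫ := by
    rw [real_inner_smul_left, real_inner_smul_right]; ring
  have h4 : ‖q • x‖ = q * ‖x‖ := by rw [norm_smul, Real.norm_eq_abs, abs_of_pos hq]
  have h5 : ‖p • y‖ = p * ‖y‖ := by rw [norm_smul, Real.norm_eq_abs, abs_of_pos hp]
  rw [h3, h4, h5] at h2
  rw [div_add_div _ _ hp.ne' hq.ne', div_le_div_iff₀ (by positivity) (by positivity)]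
  have key : (‖x‖ ^ 2 * q + p * ‖y‖ ^ 2) * (p + q) - ‖x + y‖ ^ 2 * (p * q) =
      ‖q • x - p • y‖ ^ 2 := by
    rw [h1, h2]; ring
  rw [← sub_nonneg, key]
  exact sq_nonneg _

/-- `e^{-s|x|²/p} e^{-s|y|²/q} ≤ e^{-s|x+y|²/(p+q)}` for `s ≥ 0`, `p, q > 0`. [folklore] -/
theorem exp_gauss_mul_le (x y : ℝ³) {s p q : ℝ} (hs : 0 ≤ s) (hp : 0 < p) (hq : 0 < q) :
    Real.exp (-s * ‖x‖ ^ 2 / p) * Real.exp (-s * ‖y‖ ^ 2 / q) ≤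
      Real.exp (-s * ‖x + y‖ ^ 2 / (p + q)) := by
  rw [← Real.exp_add, Real.exp_le_exp]
  have h := norm_add_sq_div_le x y hp hq
  calc -s * ‖x‖ ^ 2 / p + -s * ‖y‖ ^ 2 / q = -s * (‖x‖ ^ 2 / p + ‖y‖ ^ 2 / q) := by ring
    _ ≤ -s * (‖x + y‖ ^ 2 / (p + q)) := mul_le_mul_of_nonpos_left h (by linarith)
    _ = -s * ‖x + y‖ ^ 2 / (p + q) := by ring

/-! ### The damped Duhamel kernel -/

/-- `∫₀ᵗ e^{-(t-s)c} ds = (1 - e^{-tc})/c` for `c ≠ 0`. [folklore] -/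
theorem integral_exp_neg_sub_mul {c : ℝ} (hc : c ≠ 0) (t : ℝ) :
    ∫ s in (0 : ℝ)..t, Real.exp (-(t - s) * c) = (1 - Real.exp (-t * c)) / c := by
  have hderiv : ∀ s ∈ Set.uIcc (0 : ℝ) t,
      HasDerivAt (fun s => Real.exp (-(t - s) * c) / c) (Real.exp (-(t - s) * c)) s := by
    intro s _
    have h1 : HasDerivAt (fun s : ℝ => -(t - s) * c) c s := by
      have := (((hasDerivAt_id s).const_sub t).neg).mul_const c
      simpa using this
    exact (h1.exp.div_const c).congr_deriv (mul_div_cancel_right₀ _ hc)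
  rw [intervalIntegral.integral_eq_sub_of_hasDerivAt hderiv
    ((by fun_prop : Continuous fun s : ℝ => Real.exp (-(t - s) * c)).intervalIntegrable _ _)]
  simp only [sub_self, neg_zero, zero_mul, Real.exp_zero, sub_zero]
  ring

/-- The damped Duhamel kernel against a slower Gaussian-in-time factor:
`∫_{(0,t]} e^{-(t-s)A} e^{-sB} ds ≤ e^{-tB}/(A - B)` for `0 ≤ B < A`, `t ≥ 0` (in `ℝ≥0∞`).
[folklore] -/
theorem lintegral_heatKernel_mul_exp_le {t A B : ℝ} (ht : 0 ≤ t) (hAB : B < A) :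
    ∫⁻ s in Ioc 0 t, ENNReal.ofReal (Real.exp (-(t - s) * A) * Real.exp (-s * B)) ≤
      ENNReal.ofReal (Real.exp (-t * B) / (A - B)) := by
  have hc : 0 < A - B := sub_pos.2 hAB
  have hpt : ∀ s : ℝ, Real.exp (-(t - s) * A) * Real.exp (-s * B) =
      Real.exp (-t * B) * Real.exp (-(t - s) * (A - B)) := by
    intro s
    rw [← Real.exp_add, ← Real.exp_add]
    congr 1; ring
  simp_rw [hpt]
  have hint : IntegrableOn (fun s : ℝ => Real.exp (-(t - s) * (A - B))) (Ioc 0 t) volume :=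
    (by fun_prop : Continuous fun s : ℝ => Real.exp (-(t - s) * (A - B))).integrableOn_Icc.mono_set
      Ioc_subset_Icc_self
  calc ∫⁻ s in Ioc 0 t, ENNReal.ofReal (Real.exp (-t * B) * Real.exp (-(t - s) * (A - B)))
      = ∫⁻ s in Ioc 0 t, ENNReal.ofReal (Real.exp (-t * B)) *
          ENNReal.ofReal (Real.exp (-(t - s) * (A - B))) := by
        refine lintegral_congr fun s => ?_
        rw [ENNReal.ofReal_mul (Real.exp_pos _).le]
    _ = ENNReal.ofReal (Real.exp (-t * B)) *
          ∫⁻ s in Ioc 0 t, ENNReal.ofReal (Real.exp (-(t - s) * (A - B))) :=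
        lintegral_const_mul' _ _ ENNReal.ofReal_ne_top
    _ = ENNReal.ofReal (Real.exp (-t * B)) *
          ENNReal.ofReal (∫ s in Ioc 0 t, Real.exp (-(t - s) * (A - B))) := by
        rw [ofReal_integral_eq_lintegral_ofReal hint]
        exact (ae_restrict_of_forall_mem measurableSet_Ioc) fun s _ => (Real.exp_pos _).le
    _ = ENNReal.ofReal (Real.exp (-t * B) * ((1 - Real.exp (-t * (A - B))) / (A - B))) := by
        rw [← ENNReal.ofReal_mul (Real.exp_pos _).le, ← intervalIntegral.integral_of_le ht,
          integral_exp_neg_sub_mul hc.ne' t]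
    _ ≤ ENNReal.ofReal (Real.exp (-t * B) / (A - B)) := by
        refine ENNReal.ofReal_le_ofReal ?_
        rw [mul_div_assoc']
        refine div_le_div_of_nonneg_right ?_ hc.le
        have := Real.exp_pos (-t * (A - B))
        nlinarith [Real.exp_pos (-t * B)]

/-- The damped Duhamel bound keeping the heat factor:
`‖duhamelPair F G t k‖ₑ ≤ ∫⁻_{s ∈ (0,t]} e^{-(t-s)|k|²} ∫⁻_{k'} |k| · 2 · ‖F(s,k-k')‖ₑ ‖G(s,k')‖ₑ`
for `t ≥ 0` (junk Bochner integrals are `0` and satisfy the bound too). [folklore] -/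
theorem enorm_duhamelPair_le_heat (F G : ℝ → ℝ³ → ℝ³) {t : ℝ} (ht : 0 ≤ t) (k : ℝ³) :
    ‖duhamelPair F G t k‖ₑ ≤ ∫⁻ s in Ioc 0 t, ENNReal.ofReal (Real.exp (-(t - s) * ‖k‖ ^ 2)) *
      ∫⁻ k', ‖k‖ₑ * (2 * (‖F s (k - k')‖ₑ * ‖G s k'‖ₑ)) := by
  rw [duhamelPair, intervalIntegral.integral_of_le ht]
  refine (enorm_integral_le_lintegral_enorm _).trans ?_
  refine setLIntegral_mono' measurableSet_Ioc fun s _ => ?_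
  rw [enorm_smul]
  have hexp : ‖Real.exp (-(t - s) * ‖k‖ ^ 2)‖ₑ = ENNReal.ofReal (Real.exp (-(t - s) * ‖k‖ ^ 2)) := by
    rw [← ofReal_norm, Real.norm_eq_abs, abs_of_pos (Real.exp_pos _)]
  rw [hexp]
  gcongr
  exact (enorm_integral_le_lintegral_enorm _).trans
    (lintegral_mono fun k' => enorm_pairIntegrand_le F G k s k')

/-! ### Time-free majorants of the modes -/

/-- The time-free majorants `h_q` of the modes: `h₀ = 0`, `h₁(k) = ‖v₀ k‖`, and for
`q = m + 2 ≥ 2`, `h_q(k) = (4/(q a)) Σ_{i : Fin (m+1)} ∫ h_{i+1}(k - k') h_{m-i+1}(k') dk'`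
(the sum over `p₁ + p₂ = q` of the convolutions, mirroring the recursion of `mode`).
[folklore] -/
def maj (v₀ : ℝ³ → ℝ³) (a : ℝ) : ℕ → ℝ³ → ℝ≥0∞
  | 0 => fun _ => 0
  | 1 => fun k => ‖v₀ k‖ₑ
  | m + 2 => fun k => ENNReal.ofReal (4 / (((m : ℝ) + 2) * a)) *
      ∑ i : Fin (m + 1), ∫⁻ k', maj v₀ a (i.1 + 1) (k - k') * maj v₀ a (m - i.1 + 1) k'

/-- `h₁ = ‖v₀‖`. [folklore] -/
theorem maj_one (v₀ : ℝ³ → ℝ³) (a : ℝ) (k : ℝ³) : maj v₀ a 1 k = ‖v₀ k‖ₑ := by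
  simp [maj]

/-- Unfolding the recursion of the majorants for `q = m + 2`. [folklore] -/
theorem maj_add_two (v₀ : ℝ³ → ℝ³) (a : ℝ) (m : ℕ) (k : ℝ³) :
    maj v₀ a (m + 2) k = ENNReal.ofReal (4 / (((m : ℝ) + 2) * a)) *
      ∑ i : Fin (m + 1), ∫⁻ k', maj v₀ a (i.1 + 1) (k - k') * maj v₀ a (m - i.1 + 1) k' := by
  rw [maj]

/-- The majorants are measurable. [folklore] -/
theorem measurable_maj {v₀ : ℝ³ → ℝ³} (hv₀ : Measurable v₀) (a : ℝ) :
    ∀ n, Measurable (maj v₀ a n) := by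
  intro n
  induction n using Nat.strong_induction_on with
  | _ n ih =>
  rcases n with _ | _ | m
  · show Measurable (maj v₀ a 0)
    have : maj v₀ a 0 = fun _ => 0 := by funext k; simp [maj]
    rw [this]
    exact measurable_const
  · show Measurable (maj v₀ a 1)
    have : maj v₀ a 1 = fun k => ‖v₀ k‖ₑ := by funext k; exact maj_one v₀ a k
    rw [this]
    exact hv₀.enorm
  · show Measurable (maj v₀ a (m + 2))
    have : maj v₀ a (m + 2) = fun k => ENNReal.ofReal (4 / (((m : ℝ) + 2) * a)) *
        ∑ i : Fin (m + 1), ∫⁻ k', maj v₀ a (i.1 + 1) (k - k') * maj v₀ a (m - i.1 + 1) k' := by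
      funext k; exact maj_add_two v₀ a m k
    rw [this]
    refine Measurable.const_mul (Finset.measurable_fun_sum _ fun i _ => ?_) _
    have hi2 := i.2
    have h1 : Measurable (maj v₀ a (i.1 + 1)) := ih _ (by omega)
    have h2 : Measurable (maj v₀ a (m - i.1 + 1)) := ih _ (by omega)
    have hF : Measurable (Function.uncurry fun k k' : ℝ³ =>
        maj v₀ a (i.1 + 1) (k - k') * maj v₀ a (m - i.1 + 1) k') :=
      (h1.comp (measurable_fst.sub measurable_snd)).mul (h2.comp measurable_snd)
    exact hF.lintegral_prod_right'

/-- Tonelli and translation invariance: `∫∫ f(k - k') g(k') dk' dk = (∫ f)(∫ g)` for measurable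
`f, g : ℝ³ → [0, ∞]`. [folklore] -/
theorem lintegral_lintegral_sub_mul {f g : ℝ³ → ℝ≥0∞} (hf : Measurable f) (hg : Measurable g) :
    ∫⁻ k, ∫⁻ k', f (k - k') * g k' = (∫⁻ k, f k) * ∫⁻ k', g k' := by
  have hmeas : Measurable (Function.uncurry fun k k' : ℝ³ => f (k - k') * g k') :=
    (hf.comp (measurable_fst.sub measurable_snd)).mul (hg.comp measurable_snd)
  rw [lintegral_lintegral_swap hmeas.aemeasurable]
  have hinner : ∀ k', ∫⁻ k, f (k - k') * g k' = (∫⁻ k, f k) * g k' := by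
    intro k'
    rw [lintegral_mul_const (f := fun k => f (k - k')) _
      (hf.comp (measurable_id.sub measurable_const))]
    congr 1
    exact lintegral_sub_right_eq_self f k'
  simp_rw [hinner]
  rw [lintegral_const_mul _ hg]

/-- Pointwise bound for a convolution: `∫ f(k - k') g(k') dk' ≤ (sup f) ∫ g`. [folklore] -/
theorem lintegral_sub_mul_le_sup {f g : ℝ³ → ℝ≥0∞} (hg : Measurable g) {S : ℝ≥0∞}
    (hS : ∀ k, f k ≤ S) (k : ℝ³) :
    ∫⁻ k', f (k - k') * g k' ≤ S * ∫⁻ k', g k' := by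
  calc ∫⁻ k', f (k - k') * g k' ≤ ∫⁻ k', S * g k' :=
        lintegral_mono fun k' => mul_le_mul_left (hS _) _
    _ = S * ∫⁻ k', g k' := lintegral_const_mul S hg

/-- **Norm bounds for the majorants**: with `ν = M₀ vol B(0,R)` and `K = 4ν/a`,
`‖h_{n+1}‖₁ ≤ ν Kⁿ` and `‖h_{n+1}‖_∞ ≤ M₀ Kⁿ`. The `q - 1` terms of the recursion for `h_q` are
absorbed by its factor `1/q`, so the purely geometric ansatz closes. [folklore] -/
theorem maj_norm_bounds {v₀ : ℝ³ → ℝ³} {a R M₀ : ℝ} (ha : 0 < a) (hv₀m : Measurable v₀)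
    (hv₀ : ∀ k, v₀ k ≠ 0 → a ≤ k 2 ∧ ‖k‖ ≤ R) (hM₀ : ∀ k, ‖v₀ k‖ ≤ M₀) :
    ∀ n : ℕ, (∫⁻ k, maj v₀ a (n + 1) k ≤
        ENNReal.ofReal (M₀ * ballVol R * (4 * (M₀ * ballVol R) / a) ^ n)) ∧
      ∀ k, maj v₀ a (n + 1) k ≤ ENNReal.ofReal (M₀ * (4 * (M₀ * ballVol R) / a) ^ n) := by
  have hM₀' : 0 ≤ M₀ := (norm_nonneg _).trans (hM₀ 0)
  set ν : ℝ := M₀ * ballVol R with hν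
  have hν0 : 0 ≤ ν := mul_nonneg hM₀' (ballVol_nonneg R)
  set K : ℝ := 4 * ν / a with hK
  have hK0 : 0 ≤ K := by positivity
  have hmeas := measurable_maj hv₀m a
  intro n
  induction n using Nat.strong_induction_on with
  | _ n ih =>
  rcases n with _ | m
  · have h1 : ∀ k, maj v₀ a 1 k = ‖mode v₀ 1 0 k‖ₑ := by
      intro k; rw [maj_one, mode_one]; simp
    refine ⟨?_, fun k => ?_⟩
    · simp_rw [h1]
      simpa using lintegral_enorm_mode_one_le hv₀ hM₀ le_rfl
    · rw [h1]
      simpa using enorm_mode_one_le hM₀ le_rfl k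
  · -- `q = m + 2`
    set c : ℝ := 4 / (((m : ℝ) + 2) * a) with hc
    have hc0 : 0 ≤ c := by positivity
    have hsumR : ∀ X : ℝ, ∑ _i : Fin (m + 1), X = ((m : ℝ) + 1) * X := by
      intro X
      rw [Finset.sum_const, Finset.card_univ, Fintype.card_fin, nsmul_eq_mul]
      push_cast
      ring
    have hfrac : ((m : ℝ) + 1) / ((m : ℝ) + 2) ≤ 1 := by
      rw [div_le_one (by positivity)]; linarith
    have hKsplit : ∀ i : Fin (m + 1), K ^ i.1 * K ^ (m - i.1) = K ^ m := fun i => by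
      rw [← pow_add, Nat.add_sub_cancel' (Nat.lt_succ_iff.1 i.2)]
    -- the two real inequalities closing the induction
    have hrealL1 : c * (((m : ℝ) + 1) * (ν * ν * K ^ m)) ≤ ν * K ^ (m + 1) := by
      have hX : 0 ≤ 4 * ν * ν * K ^ m / a := by positivity
      calc c * (((m : ℝ) + 1) * (ν * ν * K ^ m))
          = 4 * ν * ν * K ^ m / a * (((m : ℝ) + 1) / ((m : ℝ) + 2)) := by
            rw [hc]; field_simp
        _ ≤ 4 * ν * ν * K ^ m / a * 1 := mul_le_mul_of_nonneg_left hfrac hX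
        _ = ν * K ^ (m + 1) := by rw [pow_succ, hK]; field_simp
    have hrealSup : c * (((m : ℝ) + 1) * (M₀ * ν * K ^ m)) ≤ M₀ * K ^ (m + 1) := by
      have hX : 0 ≤ 4 * M₀ * ν * K ^ m / a := by positivity
      calc c * (((m : ℝ) + 1) * (M₀ * ν * K ^ m))
          = 4 * M₀ * ν * K ^ m / a * (((m : ℝ) + 1) / ((m : ℝ) + 2)) := by
            rw [hc]; field_simp
        _ ≤ 4 * M₀ * ν * K ^ m / a * 1 := mul_le_mul_of_nonneg_left hfrac hX
        _ = M₀ * K ^ (m + 1) := by rw [pow_succ, hK]; field_simp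
    -- measurability of the convolutions
    have hconv_meas : ∀ i : Fin (m + 1), Measurable fun k : ℝ³ =>
        ∫⁻ k', maj v₀ a (i.1 + 1) (k - k') * maj v₀ a (m - i.1 + 1) k' := by
      intro i
      have hF : Measurable (Function.uncurry fun k k' : ℝ³ =>
          maj v₀ a (i.1 + 1) (k - k') * maj v₀ a (m - i.1 + 1) k') :=
        ((hmeas _).comp (measurable_fst.sub measurable_snd)).mul ((hmeas _).comp measurable_snd)
      exact hF.lintegral_prod_right'
    show (∫⁻ k, maj v₀ a (m + 2) k ≤ ENNReal.ofReal (ν * K ^ (m + 1))) ∧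
      ∀ k, maj v₀ a (m + 2) k ≤ ENNReal.ofReal (M₀ * K ^ (m + 1))
    refine ⟨?_, fun k => ?_⟩
    · -- `L¹`
      calc ∫⁻ k, maj v₀ a (m + 2) k
          = ∫⁻ k, ENNReal.ofReal c * ∑ i : Fin (m + 1),
              ∫⁻ k', maj v₀ a (i.1 + 1) (k - k') * maj v₀ a (m - i.1 + 1) k' := by
            simp only [maj_add_two, hc]
        _ = ENNReal.ofReal c * ∑ i : Fin (m + 1),
              ∫⁻ k, ∫⁻ k', maj v₀ a (i.1 + 1) (k - k') * maj v₀ a (m - i.1 + 1) k' := by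
            rw [lintegral_const_mul' _ _ ENNReal.ofReal_ne_top,
              lintegral_finsetSum _ fun i _ => hconv_meas i]
        _ = ENNReal.ofReal c * ∑ i : Fin (m + 1),
              (∫⁻ k, maj v₀ a (i.1 + 1) k) * ∫⁻ k', maj v₀ a (m - i.1 + 1) k' := by
            congr 1
            exact Finset.sum_congr rfl fun i _ => lintegral_lintegral_sub_mul (hmeas _) (hmeas _)
        _ ≤ ENNReal.ofReal c * ∑ i : Fin (m + 1),
              ENNReal.ofReal (ν * K ^ i.1) * ENNReal.ofReal (ν * K ^ (m - i.1)) := by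
            gcongr with i _
            · exact (ih i.1 (by have := i.2; omega)).1
            · exact (ih (m - i.1) (by omega)).1
        _ = ENNReal.ofReal (c * ∑ i : Fin (m + 1), ν * K ^ i.1 * (ν * K ^ (m - i.1))) := by
            rw [ENNReal.ofReal_mul hc0, ENNReal.ofReal_sum_of_nonneg fun i _ => by positivity]
            congr 1
            exact Finset.sum_congr rfl fun i _ => (ENNReal.ofReal_mul (by positivity)).symm
        _ = ENNReal.ofReal (c * (((m : ℝ) + 1) * (ν * ν * K ^ m))) := by
            congr 2
            rw [← hsumR]
            exact Finset.sum_congr rfl fun i _ => by rw [← hKsplit i]; ring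
        _ ≤ ENNReal.ofReal (ν * K ^ (m + 1)) := ENNReal.ofReal_le_ofReal hrealL1
    · -- sup
      calc maj v₀ a (m + 2) k
          = ENNReal.ofReal c * ∑ i : Fin (m + 1),
              ∫⁻ k', maj v₀ a (i.1 + 1) (k - k') * maj v₀ a (m - i.1 + 1) k' := by
            rw [maj_add_two]
        _ ≤ ENNReal.ofReal c * ∑ i : Fin (m + 1),
              ENNReal.ofReal (M₀ * K ^ i.1) * ∫⁻ k', maj v₀ a (m - i.1 + 1) k' := by
            gcongr with i _
            exact lintegral_sub_mul_le_sup (hmeas _) (ih i.1 (by have := i.2; omega)).2 k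
        _ ≤ ENNReal.ofReal c * ∑ i : Fin (m + 1),
              ENNReal.ofReal (M₀ * K ^ i.1) * ENNReal.ofReal (ν * K ^ (m - i.1)) := by
            gcongr with i _
            exact (ih (m - i.1) (by omega)).1
        _ = ENNReal.ofReal (c * ∑ i : Fin (m + 1), M₀ * K ^ i.1 * (ν * K ^ (m - i.1))) := by
            rw [ENNReal.ofReal_mul hc0, ENNReal.ofReal_sum_of_nonneg fun i _ => by positivity]
            congr 1
            exact Finset.sum_congr rfl fun i _ => (ENNReal.ofReal_mul (by positivity)).symm
        _ = ENNReal.ofReal (c * (((m : ℝ) + 1) * (M₀ * ν * K ^ m))) := by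
            congr 2
            rw [← hsumR]
            exact Finset.sum_congr rfl fun i _ => by rw [← hKsplit i]; ring
        _ ≤ ENNReal.ofReal (M₀ * K ^ (m + 1)) := ENNReal.ofReal_le_ofReal hrealSup

/-! ### The modes are dominated by the Gaussian-weighted majorants, uniformly in time -/

/-- Algebra of the constants in the pair bound: `X · (|k| · 2 · C) = (X |k| 2) · C` in `ℝ≥0∞`
for real `X ≥ 0`. [folklore] -/
theorem ofReal_mul_enorm_two_mul {X : ℝ} (hX : 0 ≤ X) (k : ℝ³) (C : ℝ≥0∞) :
    ENNReal.ofReal X * (‖k‖ₑ * 2 * C) = ENNReal.ofReal (X * ‖k‖ * 2) * C := by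
  rw [ENNReal.ofReal_mul (by positivity : 0 ≤ X * ‖k‖), ENNReal.ofReal_mul hX,
    ENNReal.ofReal_ofNat, ofReal_norm]
  ring

/-- **The modes are bounded, uniformly in time, by Gaussian-weighted time-free majorants.**
For a measurable datum vanishing off `{a ≤ k₃, |k| ≤ R}` with `a > 0`, for every `n`, every
`t ≥ 0` and every `k`,
`‖mode v₀ (n+1) (t, k)‖ ≤ e^{-t|k|²/(n+1)} h_{n+1}(k)`, `h = LiSinai.maj v₀ a`.
Strong induction on `n`: in the Duhamel pair of `mode (i+1)` and `mode (m-i+1)` the weights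
`e^{-s|k-k'|²/(i+1)} e^{-s|k'|²/(m-i+1)} ≤ e^{-s|k|²/(m+2)}` factor out of the convolution
(`exp_gauss_mul_le`), the damped kernel gives `∫₀ᵗ e^{-(t-s)|k|²} e^{-s|k|²/(m+2)} ds ≤
2 e^{-t|k|²/(m+2)}/|k|²` (`lintegral_heatKernel_mul_exp_le`), and on the support of
`mode (m+2) (t, ·)` one has `|k| ≥ k₃ ≥ (m+2) a` (`mode_support`), so that
`|k| · 2 · 2/|k|² ≤ 4/((m+2) a)`. [folklore] -/
theorem enorm_mode_le_gauss_maj {v₀ : ℝ³ → ℝ³} {a R : ℝ} (ha : 0 < a) (hv₀m : Measurable v₀)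
    (hv₀ : ∀ k, v₀ k ≠ 0 → a ≤ k 2 ∧ ‖k‖ ≤ R) :
    ∀ n : ℕ, ∀ t : ℝ, 0 ≤ t → ∀ k : ℝ³, ‖mode v₀ (n + 1) t k‖ₑ ≤
      ENNReal.ofReal (Real.exp (-t * ‖k‖ ^ 2 / ((n : ℝ) + 1))) * maj v₀ a (n + 1) k := by
  have hmeas := measurable_maj hv₀m a
  intro n
  induction n using Nat.strong_induction_on with
  | _ n ih =>
  intro t ht k
  rcases n with _ | m
  · -- `n = 0`: `mode 1 = e^{-t|k|²} v₀`, equality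
    rw [mode_one, maj_one, enorm_smul, ← ofReal_norm (Real.exp _), Real.norm_eq_abs,
      abs_of_pos (Real.exp_pos _)]
    simp
  · -- `q = m + 2`
    by_cases hk0 : mode v₀ (m + 2) t k = 0
    · simp [hk0]
    set q : ℝ := (m : ℝ) + 2 with hq
    have hq2 : (2 : ℝ) ≤ q := by rw [hq]; linarith [(Nat.cast_nonneg m : (0 : ℝ) ≤ m)]
    have hq0 : 0 < q := by linarith
    have hsupp := mode_support hv₀ (m + 2) t k hk0
    have hqa : q * a ≤ ‖k‖ := by
      have h1 : ((m + 2 : ℕ) : ℝ) * a ≤ k 2 := hsupp.1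
      push_cast at h1
      exact h1.trans ((le_abs_self _).trans (by simpa using PiLp.norm_apply_le k 2))
    have hkpos : 0 < ‖k‖ := lt_of_lt_of_le (by positivity) hqa
    have hcast : (((m + 1 : ℕ) : ℝ) + 1) = q := by rw [hq]; push_cast; ring
    rw [hcast]
    -- the bound for each Duhamel pair
    have hpair : ∀ i : Fin (m + 1),
        ‖duhamelPair (mode v₀ (i.1 + 1)) (mode v₀ (m - i.1 + 1)) t k‖ₑ ≤
          ENNReal.ofReal (Real.exp (-t * ‖k‖ ^ 2 / q) * (4 / (q * a))) *
            ∫⁻ k', maj v₀ a (i.1 + 1) (k - k') * maj v₀ a (m - i.1 + 1) k' := by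
      intro i
      have hi : i.1 ≤ m := Nat.lt_succ_iff.1 i.2
      set p₁ : ℝ := (i.1 : ℝ) + 1 with hp₁
      set p₂ : ℝ := ((m - i.1 : ℕ) : ℝ) + 1 with hp₂
      have hp₁0 : 0 < p₁ := by positivity
      have hp₂0 : 0 < p₂ := by positivity
      have hp12 : p₁ + p₂ = q := by
        have h : ((i.1 : ℕ) : ℝ) + ((m - i.1 : ℕ) : ℝ) = m := by
          rw [← Nat.cast_add]; congr 1; omega
        rw [hp₁, hp₂, hq]; linarith
      have ih₁ := ih i.1 (by omega)
      have ih₂ := ih (m - i.1) (by omega)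
      set conv : ℝ≥0∞ := ∫⁻ k', maj v₀ a (i.1 + 1) (k - k') * maj v₀ a (m - i.1 + 1) k'
        with hconv
      have hconv_meas : Measurable fun k' : ℝ³ =>
          maj v₀ a (i.1 + 1) (k - k') * maj v₀ a (m - i.1 + 1) k' :=
        ((hmeas _).comp (measurable_const.sub measurable_id)).mul (hmeas _)
      -- the inner (convolution) bound at a time `σ ≥ 0`
      have hinner : ∀ σ : ℝ, 0 ≤ σ →
          ∫⁻ k', ‖k‖ₑ * (2 * (‖mode v₀ (i.1 + 1) σ (k - k')‖ₑ * ‖mode v₀ (m - i.1 + 1) σ k'‖ₑ)) ≤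
            (‖k‖ₑ * 2 * ENNReal.ofReal (Real.exp (-σ * (‖k‖ ^ 2 / q)))) * conv := by
        intro σ hσ
        rw [hconv, ← lintegral_const_mul _ hconv_meas]
        refine lintegral_mono fun k' => ?_
        have h1 := ih₁ σ hσ (k - k')
        have h2 := ih₂ σ hσ k'
        have hgauss : ENNReal.ofReal (Real.exp (-σ * ‖k - k'‖ ^ 2 / p₁)) *
            ENNReal.ofReal (Real.exp (-σ * ‖k'‖ ^ 2 / p₂)) ≤
            ENNReal.ofReal (Real.exp (-σ * (‖k‖ ^ 2 / q))) := by
          rw [← ENNReal.ofReal_mul (Real.exp_pos _).le]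
          refine ENNReal.ofReal_le_ofReal ?_
          have := exp_gauss_mul_le (k - k') k' hσ hp₁0 hp₂0
          rw [sub_add_cancel, hp12] at this
          exact this.trans_eq (by rw [mul_div_assoc])
        calc ‖k‖ₑ * (2 * (‖mode v₀ (i.1 + 1) σ (k - k')‖ₑ * ‖mode v₀ (m - i.1 + 1) σ k'‖ₑ))
            ≤ ‖k‖ₑ * (2 * ((ENNReal.ofReal (Real.exp (-σ * ‖k - k'‖ ^ 2 / p₁)) *
                maj v₀ a (i.1 + 1) (k - k')) *
                (ENNReal.ofReal (Real.exp (-σ * ‖k'‖ ^ 2 / p₂)) * maj v₀ a (m - i.1 + 1) k'))) := by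
              gcongr
          _ = ‖k‖ₑ * 2 * (ENNReal.ofReal (Real.exp (-σ * ‖k - k'‖ ^ 2 / p₁)) *
                ENNReal.ofReal (Real.exp (-σ * ‖k'‖ ^ 2 / p₂))) *
                (maj v₀ a (i.1 + 1) (k - k') * maj v₀ a (m - i.1 + 1) k') := by ring
          _ ≤ ‖k‖ₑ * 2 * ENNReal.ofReal (Real.exp (-σ * (‖k‖ ^ 2 / q))) *
                (maj v₀ a (i.1 + 1) (k - k') * maj v₀ a (m - i.1 + 1) k') := by
              gcongr
      -- measurability of the scalar kernel
      have hker_meas : Measurable fun σ : ℝ =>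
          ENNReal.ofReal (Real.exp (-(t - σ) * ‖k‖ ^ 2) * Real.exp (-σ * (‖k‖ ^ 2 / q))) :=
        ENNReal.measurable_ofReal.comp (by fun_prop)
      -- the kernel integral
      have hB_lt : ‖k‖ ^ 2 / q < ‖k‖ ^ 2 := div_lt_self (by positivity) (by linarith)
      have hker : ∫⁻ σ in Ioc 0 t, ENNReal.ofReal (Real.exp (-(t - σ) * ‖k‖ ^ 2) *
          Real.exp (-σ * (‖k‖ ^ 2 / q))) ≤
          ENNReal.ofReal (Real.exp (-t * (‖k‖ ^ 2 / q)) * (2 / ‖k‖ ^ 2)) := by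
        refine (lintegral_heatKernel_mul_exp_le ht hB_lt).trans (ENNReal.ofReal_le_ofReal ?_)
        have hhalf : ‖k‖ ^ 2 / 2 ≤ ‖k‖ ^ 2 - ‖k‖ ^ 2 / q := by
          have := div_le_div_of_nonneg_left (sq_nonneg ‖k‖) two_pos hq2
          linarith
        calc Real.exp (-t * (‖k‖ ^ 2 / q)) / (‖k‖ ^ 2 - ‖k‖ ^ 2 / q)
            ≤ Real.exp (-t * (‖k‖ ^ 2 / q)) / (‖k‖ ^ 2 / 2) :=
              div_le_div_of_nonneg_left (Real.exp_pos _).le (by positivity) hhalf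
          _ = Real.exp (-t * (‖k‖ ^ 2 / q)) * (2 / ‖k‖ ^ 2) := by
              rw [div_div_eq_mul_div, mul_div_assoc]
      -- the real constant
      have hconst : Real.exp (-t * (‖k‖ ^ 2 / q)) * (2 / ‖k‖ ^ 2) * ‖k‖ * 2 ≤
          Real.exp (-t * ‖k‖ ^ 2 / q) * (4 / (q * a)) := by
        have h4 : (4 : ℝ) / ‖k‖ ≤ 4 / (q * a) :=
          div_le_div_of_nonneg_left (by norm_num) (by positivity) hqa
        calc Real.exp (-t * (‖k‖ ^ 2 / q)) * (2 / ‖k‖ ^ 2) * ‖k‖ * 2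
            = Real.exp (-t * ‖k‖ ^ 2 / q) * (4 / ‖k‖) := by
              rw [← mul_div_assoc]; field_simp; ring
          _ ≤ Real.exp (-t * ‖k‖ ^ 2 / q) * (4 / (q * a)) :=
              mul_le_mul_of_nonneg_left h4 (Real.exp_pos _).le
      calc ‖duhamelPair (mode v₀ (i.1 + 1)) (mode v₀ (m - i.1 + 1)) t k‖ₑ
          ≤ ∫⁻ σ in Ioc 0 t, ENNReal.ofReal (Real.exp (-(t - σ) * ‖k‖ ^ 2)) *
              ∫⁻ k', ‖k‖ₑ * (2 * (‖mode v₀ (i.1 + 1) σ (k - k')‖ₑ *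
                ‖mode v₀ (m - i.1 + 1) σ k'‖ₑ)) := enorm_duhamelPair_le_heat _ _ ht k
        _ ≤ ∫⁻ σ in Ioc 0 t, ENNReal.ofReal (Real.exp (-(t - σ) * ‖k‖ ^ 2)) *
              ((‖k‖ₑ * 2 * ENNReal.ofReal (Real.exp (-σ * (‖k‖ ^ 2 / q)))) * conv) :=
            setLIntegral_mono' measurableSet_Ioc fun σ hσ =>
              mul_le_mul_right (hinner σ hσ.1.le) _
        _ = ∫⁻ σ in Ioc 0 t, ENNReal.ofReal (Real.exp (-(t - σ) * ‖k‖ ^ 2) *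
              Real.exp (-σ * (‖k‖ ^ 2 / q))) * (‖k‖ₑ * 2 * conv) := by
            refine lintegral_congr fun σ => ?_
            rw [ENNReal.ofReal_mul (Real.exp_pos _).le]
            ring
        _ = (∫⁻ σ in Ioc 0 t, ENNReal.ofReal (Real.exp (-(t - σ) * ‖k‖ ^ 2) *
              Real.exp (-σ * (‖k‖ ^ 2 / q)))) * (‖k‖ₑ * 2 * conv) :=
            lintegral_mul_const _ hker_meas
        _ ≤ ENNReal.ofReal (Real.exp (-t * (‖k‖ ^ 2 / q)) * (2 / ‖k‖ ^ 2)) *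
              (‖k‖ₑ * 2 * conv) := mul_le_mul_left hker _
        _ = ENNReal.ofReal (Real.exp (-t * (‖k‖ ^ 2 / q)) * (2 / ‖k‖ ^ 2) * ‖k‖ * 2) * conv :=
            ofReal_mul_enorm_two_mul (by positivity) k conv
        _ ≤ ENNReal.ofReal (Real.exp (-t * ‖k‖ ^ 2 / q) * (4 / (q * a))) * conv :=
            mul_le_mul_left (ENNReal.ofReal_le_ofReal hconst) _
    -- summing over the antidiagonal
    calc ‖mode v₀ (m + 2) t k‖ₑ
        = ‖∑ i : Fin (m + 1), duhamelPair (mode v₀ (i.1 + 1)) (mode v₀ (m - i.1 + 1)) t k‖ₑ := by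
          rw [mode_add_two]
      _ ≤ ∑ i : Fin (m + 1), ‖duhamelPair (mode v₀ (i.1 + 1)) (mode v₀ (m - i.1 + 1)) t k‖ₑ :=
          enorm_sum_le _ _
      _ ≤ ∑ i : Fin (m + 1), ENNReal.ofReal (Real.exp (-t * ‖k‖ ^ 2 / q) * (4 / (q * a))) *
            ∫⁻ k', maj v₀ a (i.1 + 1) (k - k') * maj v₀ a (m - i.1 + 1) k' :=
          Finset.sum_le_sum fun i _ => hpair i
      _ = ENNReal.ofReal (Real.exp (-t * ‖k‖ ^ 2 / q)) * maj v₀ a (m + 2) k := by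
          rw [maj_add_two, ← Finset.mul_sum, ENNReal.ofReal_mul (Real.exp_pos _).le, mul_assoc,
            hq]

/-- **Uniform-in-time geometric bounds with exponential decay.** For a measurable datum bounded
by `M₀` and vanishing off `{a ≤ k₃, |k| ≤ R}` with `a > 0`: for every `n`, `t ≥ 0` and `k`,
`‖mode v₀ (n+1) (t, k)‖ ≤ M₀ Kⁿ e^{-t (n+1) a²}` with `K = 4 M₀ vol B(0,R) / a`
(`|k|² ≥ ((n+1) a)²` on the support of the mode, `enorm_mode_le_gauss_maj`, `maj_norm_bounds`).
In particular the sup norms of all the terms of the series (3) are bounded uniformly in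
`t ∈ [0, ∞)` by a geometric sequence, and each decays exponentially as `t → ∞`. [folklore] -/
theorem enorm_mode_le_geometric_exp {v₀ : ℝ³ → ℝ³} {a R M₀ : ℝ} (ha : 0 < a)
    (hv₀m : Measurable v₀) (hv₀ : ∀ k, v₀ k ≠ 0 → a ≤ k 2 ∧ ‖k‖ ≤ R) (hM₀ : ∀ k, ‖v₀ k‖ ≤ M₀)
    (n : ℕ) {t : ℝ} (ht : 0 ≤ t) (k : ℝ³) :
    ‖mode v₀ (n + 1) t k‖ₑ ≤ ENNReal.ofReal (M₀ * (4 * (M₀ * ballVol R) / a) ^ n *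
      Real.exp (-(t * ((n : ℝ) + 1) * a ^ 2))) := by
  by_cases hk0 : mode v₀ (n + 1) t k = 0
  · simp [hk0]
  have hM₀' : 0 ≤ M₀ := (norm_nonneg _).trans (hM₀ 0)
  have hsupp := mode_support hv₀ (n + 1) t k hk0
  have hn0 : (0 : ℝ) < (n : ℝ) + 1 := by positivity
  have hqa : ((n : ℝ) + 1) * a ≤ ‖k‖ := by
    have h1 : ((n + 1 : ℕ) : ℝ) * a ≤ k 2 := hsupp.1
    push_cast at h1
    exact h1.trans ((le_abs_self _).trans (by simpa using PiLp.norm_apply_le k 2))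
  have hexp : Real.exp (-t * ‖k‖ ^ 2 / ((n : ℝ) + 1)) ≤ Real.exp (-(t * ((n : ℝ) + 1) * a ^ 2)) := by
    rw [Real.exp_le_exp]
    have hsq : (((n : ℝ) + 1) * a) ^ 2 ≤ ‖k‖ ^ 2 :=
      pow_le_pow_left₀ (by positivity) hqa 2
    have h1 : t * (((n : ℝ) + 1) * a ^ 2) ≤ t * (‖k‖ ^ 2 / ((n : ℝ) + 1)) := by
      refine mul_le_mul_of_nonneg_left ?_ ht
      rw [le_div_iff₀ hn0]
      nlinarith
    calc -t * ‖k‖ ^ 2 / ((n : ℝ) + 1) = -(t * (‖k‖ ^ 2 / ((n : ℝ) + 1))) := by ring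
      _ ≤ -(t * (((n : ℝ) + 1) * a ^ 2)) := neg_le_neg h1
      _ = -(t * ((n : ℝ) + 1) * a ^ 2) := by ring
  calc ‖mode v₀ (n + 1) t k‖ₑ
      ≤ ENNReal.ofReal (Real.exp (-t * ‖k‖ ^ 2 / ((n : ℝ) + 1))) * maj v₀ a (n + 1) k :=
        enorm_mode_le_gauss_maj ha hv₀m hv₀ n t ht k
    _ ≤ ENNReal.ofReal (Real.exp (-(t * ((n : ℝ) + 1) * a ^ 2))) *
          ENNReal.ofReal (M₀ * (4 * (M₀ * ballVol R) / a) ^ n) :=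
        mul_le_mul' (ENNReal.ofReal_le_ofReal hexp) ((maj_norm_bounds ha hv₀m hv₀ hM₀ n).2 k)
    _ = ENNReal.ofReal (M₀ * (4 * (M₀ * ballVol R) / a) ^ n *
          Real.exp (-(t * ((n : ℝ) + 1) * a ^ 2))) := by
        rw [← ENNReal.ofReal_mul (Real.exp_pos _).le]
        ring_nf

/-- Real-norm form of `enorm_mode_le_geometric_exp`. [folklore] -/
theorem norm_mode_le_geometric_exp {v₀ : ℝ³ → ℝ³} {a R M₀ : ℝ} (ha : 0 < a)
    (hv₀m : Measurable v₀) (hv₀ : ∀ k, v₀ k ≠ 0 → a ≤ k 2 ∧ ‖k‖ ≤ R) (hM₀ : ∀ k, ‖v₀ k‖ ≤ M₀)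
    (n : ℕ) {t : ℝ} (ht : 0 ≤ t) (k : ℝ³) :
    ‖mode v₀ (n + 1) t k‖ ≤ M₀ * (4 * (M₀ * ballVol R) / a) ^ n *
      Real.exp (-(t * ((n : ℝ) + 1) * a ^ 2)) := by
  have hM₀' : 0 ≤ M₀ := (norm_nonneg _).trans (hM₀ 0)
  have hK0 : 0 ≤ 4 * (M₀ * ballVol R) / a := by
    have := ballVol_nonneg R; positivity
  rw [← ENNReal.ofReal_le_ofReal_iff (by positivity), ofReal_norm]
  exact enorm_mode_le_geometric_exp ha hv₀m hv₀ hM₀ n ht k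

/-! ### Finite energy for large times; small data -/

/-- **The energy returns: finite energy whenever `K e^{-t a²} < 1`.** For a measurable datum
bounded by `M₀`, vanishing off `{a ≤ k₃, |k| ≤ R}` with `a > 0`, and every `t ≥ 0` with
`K e^{-t a²} < 1`, `K = 4 M₀ vol B(0,R) / a`, the series solution has finite energy
`∫ |seriesSolution v₀ (k, t)|² dk < ∞`: its modes decay geometrically at `t`
(`norm_mode_le_geometric_exp`) and `energy_lt_top_of_mode_geometric` applies. Together with the
small-time theorem `seriesSolution_energy_lt_top` (finite energy on `[0, t₀)`) this confines the
infinite-energy times of every admissible datum to a compact interval `[t₀, T]`. [folklore] -/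
theorem seriesSolution_energy_lt_top_of_exp_lt {v₀ : ℝ³ → ℝ³} {a R M₀ : ℝ} (ha : 0 < a)
    (hv₀m : Measurable v₀) (hv₀ : ∀ k, v₀ k ≠ 0 → a ≤ k 2 ∧ ‖k‖ ≤ R) (hM₀ : ∀ k, ‖v₀ k‖ ≤ M₀)
    {t : ℝ} (ht : 0 ≤ t) (hKt : 4 * (M₀ * ballVol R) / a * Real.exp (-(t * a ^ 2)) < 1) :
    ∫⁻ k, ‖seriesSolution v₀ t k‖ₑ ^ 2 < ∞ := by
  have hM₀' : 0 ≤ M₀ := (norm_nonneg _).trans (hM₀ 0)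
  set K : ℝ := 4 * (M₀ * ballVol R) / a with hK
  have hK0 : 0 ≤ K := by have := ballVol_nonneg R; positivity
  set r : ℝ := K * Real.exp (-(t * a ^ 2)) with hr
  have hr0 : 0 ≤ r := by positivity
  set q : ℝ := max r (1 / 2) with hq
  have hq0 : 0 ≤ q := hr0.trans (le_max_left _ _)
  have hq1 : q < 1 := max_lt hKt (by norm_num)
  have hq2 : 1 ≤ 2 * q := by linarith [le_max_right r (1 / 2)]
  refine energy_lt_top_of_mode_geometric ha hv₀m hv₀ (C := 2 * M₀) hq0 hq1 fun p k => ?_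
  rcases p with _ | n
  · simp [mode_zero]; positivity
  · have hexp1 : Real.exp (-(t * a ^ 2)) ≤ 1 := by
      rw [Real.exp_le_one_iff]; nlinarith [sq_nonneg a]
    calc ‖mode v₀ (n + 1) t k‖ ≤ M₀ * K ^ n * Real.exp (-(t * ((n : ℝ) + 1) * a ^ 2)) :=
          norm_mode_le_geometric_exp ha hv₀m hv₀ hM₀ n ht k
      _ = M₀ * r ^ n * Real.exp (-(t * a ^ 2)) := by
          rw [hr, mul_pow, ← Real.exp_nat_mul, ← mul_assoc, mul_assoc (M₀ * K ^ n),
            ← Real.exp_add]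
          congr 2; ring
      _ ≤ M₀ * r ^ n * 1 := mul_le_mul_of_nonneg_left hexp1 (by positivity)
      _ ≤ M₀ * q ^ n * 1 := by gcongr; exact le_max_left _ _
      _ ≤ M₀ * q ^ n * (2 * q) := mul_le_mul_of_nonneg_left hq2 (by positivity)
      _ = 2 * M₀ * q ^ (n + 1) := by ring

/-- **Finite energy at all large times.** With `K = 4 M₀ vol B(0,R) / a` and `T = (K + 1)/a²`,
the series solution has finite energy at every `t ≥ T` (since `K e^{-(K+1)} < 1`). Hence the
set of times of infinite energy of any admissible datum is bounded. [folklore] -/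
theorem seriesSolution_energy_lt_top_of_le {v₀ : ℝ³ → ℝ³} {a R M₀ : ℝ} (ha : 0 < a)
    (hv₀m : Measurable v₀) (hv₀ : ∀ k, v₀ k ≠ 0 → a ≤ k 2 ∧ ‖k‖ ≤ R) (hM₀ : ∀ k, ‖v₀ k‖ ≤ M₀)
    {t : ℝ} (ht : (4 * (M₀ * ballVol R) / a + 1) / a ^ 2 ≤ t) :
    ∫⁻ k, ‖seriesSolution v₀ t k‖ₑ ^ 2 < ∞ := by
  have hM₀' : 0 ≤ M₀ := (norm_nonneg _).trans (hM₀ 0)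
  set K : ℝ := 4 * (M₀ * ballVol R) / a with hK
  have hK0 : 0 ≤ K := by have := ballVol_nonneg R; positivity
  have ha2 : 0 < a ^ 2 := by positivity
  have ht0 : 0 ≤ t := le_trans (by positivity) ht
  refine seriesSolution_energy_lt_top_of_exp_lt ha hv₀m hv₀ hM₀ ht0 ?_
  have h1 : K + 1 ≤ t * a ^ 2 := by rwa [div_le_iff₀ ha2] at ht
  have h2 : Real.exp (-(t * a ^ 2)) ≤ Real.exp (-(K + 1)) := Real.exp_le_exp.2 (neg_le_neg h1)
  have h3 : K < Real.exp (K + 1) := by linarith [Real.add_one_le_exp (K + 1)]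
  calc K * Real.exp (-(t * a ^ 2)) ≤ K * Real.exp (-(K + 1)) :=
        mul_le_mul_of_nonneg_left h2 hK0
    _ < 1 := by
        rw [Real.exp_neg, ← div_eq_mul_inv, div_lt_one (Real.exp_pos _)]
        exact h3

/-- **All singular times lie below `T = (K + 1)/a²`**: if the energy of the series solution is
infinite at `t`, then `t < (K + 1)/a²`, `K = 4 M₀ vol B(0,R) / a`. [folklore] -/
theorem lt_of_energy_eq_top {v₀ : ℝ³ → ℝ³} {a R M₀ : ℝ} (ha : 0 < a)
    (hv₀m : Measurable v₀) (hv₀ : ∀ k, v₀ k ≠ 0 → a ≤ k 2 ∧ ‖k‖ ≤ R) (hM₀ : ∀ k, ‖v₀ k‖ ≤ M₀)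
    {t : ℝ} (hinf : ∫⁻ k, ‖seriesSolution v₀ t k‖ₑ ^ 2 = ∞) :
    t < (4 * (M₀ * ballVol R) / a + 1) / a ^ 2 := by
  by_contra h
  exact (seriesSolution_energy_lt_top_of_le ha hv₀m hv₀ hM₀ (not_lt.1 h)).ne hinf

/-- **Small one-sided complex data never blow up.** If `4 M₀ vol B(0,R) < a` (i.e. `K < 1`),
the series solution of a measurable datum bounded by `M₀` and vanishing off
`{a ≤ k₃, |k| ≤ R}` has finite energy at EVERY time `t ≥ 0`. [folklore] -/
theorem seriesSolution_energy_lt_top_of_small {v₀ : ℝ³ → ℝ³} {a R M₀ : ℝ} (ha : 0 < a)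
    (hv₀m : Measurable v₀) (hv₀ : ∀ k, v₀ k ≠ 0 → a ≤ k 2 ∧ ‖k‖ ≤ R) (hM₀ : ∀ k, ‖v₀ k‖ ≤ M₀)
    (hsmall : 4 * (M₀ * ballVol R) < a) {t : ℝ} (ht : 0 ≤ t) :
    ∫⁻ k, ‖seriesSolution v₀ t k‖ₑ ^ 2 < ∞ := by
  have hM₀' : 0 ≤ M₀ := (norm_nonneg _).trans (hM₀ 0)
  have hK0 : 0 ≤ 4 * (M₀ * ballVol R) / a := by have := ballVol_nonneg R; positivity
  refine seriesSolution_energy_lt_top_of_exp_lt ha hv₀m hv₀ hM₀ ht ?_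
  have hK1 : 4 * (M₀ * ballVol R) / a < 1 := (div_lt_one ha).2 hsmall
  have hexp1 : Real.exp (-(t * a ^ 2)) ≤ 1 := by
    rw [Real.exp_le_one_iff]; nlinarith [sq_nonneg a]
  calc 4 * (M₀ * ballVol R) / a * Real.exp (-(t * a ^ 2)) ≤ 4 * (M₀ * ballVol R) / a * 1 :=
        mul_le_mul_of_nonneg_left hexp1 hK0
    _ < 1 := by rw [mul_one]; exact hK1

/-- **Blow-up needs large data, quantitatively**: if the series solution of an admissible datum
(`a > 0`, bound `M₀`, support in `{a ≤ k₃, |k| ≤ R}`) has infinite energy at some time `t ≥ 0`,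
then `a ≤ 4 M₀ vol B(0,R)`. In particular every witness of `LiSinaiSeriesEnergyInfinite`, of
`LiSinaiSeriesEnergyBlowup`, and the critical datum `A_cr(t) v(k,0)` of §10 p. 312, satisfies
this inequality. [folklore] -/
theorem le_of_energy_eq_top {v₀ : ℝ³ → ℝ³} {a R M₀ : ℝ} (ha : 0 < a)
    (hv₀m : Measurable v₀) (hv₀ : ∀ k, v₀ k ≠ 0 → a ≤ k 2 ∧ ‖k‖ ≤ R) (hM₀ : ∀ k, ‖v₀ k‖ ≤ M₀)
    {t : ℝ} (ht : 0 ≤ t) (hinf : ∫⁻ k, ‖seriesSolution v₀ t k‖ₑ ^ 2 = ∞) :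
    a ≤ 4 * (M₀ * ballVol R) := by
  by_contra h
  exact (seriesSolution_energy_lt_top_of_small ha hv₀m hv₀ hM₀ (not_le.1 h) ht).ne hinf

end LiSinai

open LiSinai in
/-- **The infinite-energy fact forces large data.** Any witness `(v₀, a, R, t)` of
`LiSinaiSeriesEnergyInfinite` with a bound `‖v₀‖ ≤ M₀` has `a ≤ 4 M₀ vol B(0,R)`
(`LiSinai.le_of_energy_eq_top`); stated here on the fact itself: it can only be witnessed in
the large-data regime `{a ≤ 4 M₀ vol B(0,R)}`. [folklore] -/
theorem LiSinaiSeriesEnergyInfinite.exists_large_witness (h : LiSinaiSeriesEnergyInfinite) :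
    ∃ (v₀ : ℝ³ → ℝ³) (a R t M₀ : ℝ), 0 < a ∧ 0 < t ∧ (∀ k, ‖v₀ k‖ ≤ M₀) ∧
      (∀ k, v₀ k ≠ 0 → a ≤ k 2 ∧ ‖k‖ ≤ R) ∧ a ≤ 4 * (M₀ * ballVol R) ∧
      ∫⁻ k, ‖seriesSolution v₀ t k‖ₑ ^ 2 = ∞ := by
  obtain ⟨v₀, a, R, t, ha, ht, hm, ⟨M₀, hM₀⟩, hsupp, -, hinf⟩ := h
  exact ⟨v₀, a, R, t, M₀, ha, ht, hM₀, hsupp, le_of_energy_eq_top ha hm hsupp hM₀ ht.le hinf,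
    hinf⟩

end Literature.Barriers.NavierStokesRegularity
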